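import Summits.PneNP.PneNP.Theorems.ChebyshevTracialDesignGiantComponent
import Summits.PneNP.PneNP.Theorems.ChebyshevTracialDesignDictionary
import HarnessLib

/-!
# Cell pnp-psdrank, route `ChebyshevTracialDesign`: SATURATED SYNCHRONISATION at every dimension — a rank-one cut side whose active tight
# partners have corank one is worth one tight rectangle plus junk (crux `TracialDecayExp20`, stmt-PneNP-19878)

Brick 73 (prover g13; MEMO-16 §3). Tightness of a psd pair gives `rank X_U + rank Y_M ≤ r` on every tight pair (brick 40). Call an active tight pair
SATURATED when equality holds: then `range Y_M = (range X_U)^⊥` EXACTLY, i.e. tightness is LABEL EQUALITY for the labels `range X_U` and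
`(range Y_M)^⊥` — the mechanism behind the `r = 2` synchronisation theorem (brick 61: after peeling, both sides have rank `1 = r − 1`). With the
giant-class lemma (brick 72) the synchronisation argument runs at EVERY `r` whenever all active tight pairs are saturated. This file does the case of a
RANK-ONE CUT SIDE (`X_U = x_U · u_U u_Uᵀ`, `‖u_U‖ = 1`, `0 ≤ x_U ≤ 1`) whose active tight matching partners have rank `r − 1`:

* `mulVec_eq_zero_of_tight` — on an active tight pair `Y_M u_U = 0`; `ker_eq_span_of_saturated` — if moreover `rank Y_M + 1 = r` then
  `ker Y_M = ℝ·u_U` (rank–nullity): the cut label `ℝ·u_U` equals the matching label `ker Y_M`;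
* **`rankOne_saturated_value_le`** — under the (SNT-q)-existence hypothesis for `tr Y/r` (bricks 59/61/72's shape; a theorem mod KL for homogeneous-dense
  trace weights, brick 65) and cut trace mass `≥ 2ε·r·#t-cuts`: `Σ_U Σ_M W tr(X_U Y_M) ≤ γ + 2·B_v·ε·r`, where `γ` bounds the tight `[0,1]`-rectangles
  (`TracialValueLEAt W γ 1`, the `r = 1` rung). Proof: giant class (brick 72) for the labels `ℝ·u_U` / `ker Y_M` ⇒ one line `ℓ*` carries all but
  `2ε` of the cut trace mass (junk `2B_v ε r` by the trace marginal); on that class `u_U u_Uᵀ = u* u*ᵀ` is a dictionary of size one, so the class is a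
  single tight `[0,1]`-rectangle `(x_U, u*ᵀ Y_M u*)` (brick 34 `value_le_of_cutDictionary`).
So at every `r` the dense cell is settled for rank-one cut sides facing corank-one matchings; what remains at `r = 3` after peeling is exactly the
UNSATURATED line–line incidence case `rank X_U = rank Y_M = 1` (MEMO-14 §5(g)), now isolated in the kernel.
[cite: Rothvoss2017, §2 (PDF p. 6)] [cite: BrietDadushPokutta2014, Thm. 6 (§3)] [cite: KupavskiiZakharov2022, §2]
Stature: support/instrument. WHAT THIS IS NOT: not the unsaturated case, not the symmetric statement (rank-one matchings vs corank-one cuts needs an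
`(r−1)`-dimensional compression), nothing on psd rank of P_PM(K_n), no P-vs-NP content.
-/

set_option linter.dupNamespace false -- `Summit.PneNP.PneNP.…`: summit = sub-problem (D-0017)

noncomputable section

namespace Summit.PneNP.PneNP.Theorems.ChebyshevTracialDesignSaturatedSynchronisation

open Finset Matrix Literature.Barriers.PneNP Literature.Combinatorics.Optimization
open Summit.PneNP.PneNP.Theorems.ChebyshevTracialDesignGiantComponent
open Summit.PneNP.PneNP.Theorems.ChebyshevTracialDesignDictionary

variable {n r : ℕ}

/-! ### §1 Saturated tight pairs: the matching kernel is the cut line -/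

/-- A rank-one cut operator `X = x · u uᵀ` with `‖u‖ = 1` acts on `u` by `X u = x u`. -/
theorem rankOne_mulVec_self {u : Fin r → ℝ} (hu : u ⬝ᵥ u = 1) (x : ℝ) : (x • vecMulVec u u) *ᵥ u = x • u := by
  rw [smul_mulVec, vecMulVec_mulVec, hu, MulOpposite.op_one, one_smul]

/-- **On an active tight pair the matching operator kills the cut direction**: if `X_U = x_U u uᵀ` with `x_U ≠ 0` and `X_U Y_M = 0`
(`Y_M`, `X_U` symmetric), then `Y_M u = 0`. [cite: BrietDadushPokutta2014, Thm. 6 (§3)] -/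
theorem mulVec_eq_zero_of_tight {X Y : Matrix (Fin r) (Fin r) ℝ} {u : Fin r → ℝ} (hu : u ⬝ᵥ u = 1) {x : ℝ} (hx : x ≠ 0)
    (hX : X = x • vecMulVec u u) (hYs : Yᵀ = Y) (hXY : X * Y = 0) : Y *ᵥ u = 0 := by
  have hXs : Xᵀ = X := by rw [hX, transpose_smul, transpose_vecMulVec]
  have hYX : Y * X = 0 := by
    have h := congrArg transpose hXY
    rwa [transpose_mul, transpose_zero, hXs, hYs] at h
  have h : Y *ᵥ (X *ᵥ u) = 0 := by rw [mulVec_mulVec, hYX, zero_mulVec]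
  rw [hX, rankOne_mulVec_self hu, mulVec_smul, smul_eq_zero] at h
  exact h.resolve_left hx

/-- **Saturation is label equality.** If moreover `rank Y_M + 1 = r`, then `ker Y_M = ℝ·u` (rank–nullity).
[cite: BrietDadushPokutta2014, Thm. 6 (§3)] -/
theorem ker_eq_span_of_saturated {Y : Matrix (Fin r) (Fin r) ℝ} {u : Fin r → ℝ} (hu : u ⬝ᵥ u = 1) (hYu : Y *ᵥ u = 0)
    (hrank : Y.rank + 1 = r) : LinearMap.ker Y.mulVecLin = ℝ ∙ u := by
  have hu0 : u ≠ 0 := by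
    intro h; rw [h, dotProduct_zero] at hu; exact zero_ne_one hu
  have hle : (ℝ ∙ u) ≤ LinearMap.ker Y.mulVecLin := by
    rw [Submodule.span_singleton_le_iff_mem, LinearMap.mem_ker]
    exact hYu
  symm
  refine Submodule.eq_of_le_of_finrank_eq hle ?_
  have hrn := LinearMap.finrank_range_add_finrank_ker Y.mulVecLin
  have hdom : Module.finrank ℝ (Fin r → ℝ) = r := by simp
  rw [finrank_span_singleton hu0]
  unfold Matrix.rank at hrank
  omega

/-! ### §2 The synchronisation theorem for saturated rank-one cut sides -/

/-- **SATURATED SYNCHRONISATION (rank-one cuts, corank-one tight partners), every dimension `r ≥ 1`.** Let `W = levelWeight n t C w`,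
`Σ|w_c| ≤ B_v`, `TracialValueLEAt W γ 1` (the tight `[0,1]`-rectangle bound), and `(X, Y)` a tight-orthogonal psd rectangle of dimension `r` on the
`t`-cuts with `X_U = x_U · u_U u_Uᵀ` (`‖u_U‖ = 1`, `0 ≤ x_U ≤ 1`) such that every ACTIVE TIGHT pair is saturated: `cc(U,M) = 1`, `x_U ≠ 0`, `Y_M ≠ 0
⇒ rank Y_M + 1 = r`. Assume (SNT-q)-existence for `tr Y/r` (hypothesis `hSNT`) and cut trace mass `Σ x_U ≥ 2ε·r·#t-cuts`... precisely
`2ε·#t-cuts ≤ Σ_U tr(X_U)/r`. Then `Σ_U Σ_M W(U,M) tr(X_U Y_M) ≤ γ + 2·B_v·ε·r`.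
[cite: Rothvoss2017, §2 (PDF p. 6)] [cite: BrietDadushPokutta2014, Thm. 6 (§3)] [cite: KupavskiiZakharov2022, §2] -/
theorem rankOne_saturated_value_le {t : ℕ} (hr : 0 < r) (hne : (univ.filter fun U : OddSet n => U.1.card = t).Nonempty)
    (C : Finset ℕ) (w : ℕ → ℝ) {Bv γ ε : ℝ} (hBv : ∑ c ∈ C, |w c| ≤ Bv) (hε : 0 < ε)
    (hγ : TracialValueLEAt (levelWeight n t C w) γ 1)
    {X : OddSet n → Matrix (Fin r) (Fin r) ℝ} {Y : PMatch n → Matrix (Fin r) (Fin r) ℝ} (hXY : IsPsdRect X Y)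
    (hXt : ∀ U, U.1.card ≠ t → X U = 0)
    (u : OddSet n → Fin r → ℝ) (hu : ∀ U, u U ⬝ᵥ u U = 1) (x : OddSet n → ℝ) (hx : ∀ U, 0 ≤ x U ∧ x U ≤ 1)
    (hX : ∀ U, X U = x U • vecMulVec (u U) (u U))
    (hsat : ∀ U M, cc U M = 1 → X U ≠ 0 → Y M ≠ 0 → (Y M).rank + 1 = r)
    (hSNT : ∀ (x' : OddSet n → ℝ) (z' : PMatch n → ℝ), (∀ U, 0 ≤ x' U ∧ x' U ≤ 1) → (∀ U, U.1.card ≠ t → x' U = 0) →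
      ε * ((univ.filter fun U : OddSet n => U.1.card = t).card : ℝ) ≤ ∑ U, x' U →
      (∀ M, 0 ≤ z' M ∧ z' M ≤ (Y M).trace / r) → (∑ M, (Y M).trace / r) ≤ 2 * ∑ M, z' M →
      ∃ U M, cc U M = 1 ∧ 0 < x' U ∧ 0 < z' M)
    (hdens : 2 * (ε * ((univ.filter fun U : OddSet n => U.1.card = t).card : ℝ)) ≤ ∑ U, (X U).trace / r) :
    ∑ U, ∑ M, levelWeight n t C w U M * (X U * Y M).trace ≤ γ + 2 * Bv * ε * r := by
  classical
  -- labels: the cut line `ℝ·u_U` and the matching kernel `ker Y_M`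
  set κ : OddSet n → Submodule ℝ (Fin r → ℝ) := fun U => ℝ ∙ u U with hκ
  set lam : PMatch n → Submodule ℝ (Fin r → ℝ) := fun M => LinearMap.ker (Y M).mulVecLin with hlam
  have hYs : ∀ M, (Y M)ᵀ = Y M := fun M => by
    have h := (hXY.2.1 M).1.1; rwa [IsHermitian, conjTranspose_eq_transpose_of_trivial] at h
  have hclosed : ∀ U M, cc U M = 1 → X U ≠ 0 → Y M ≠ 0 → κ U = lam M := by
    intro U M hcc hXU hYM
    have hxU : x U ≠ 0 := by intro h0; exact hXU (by rw [hX U, h0, zero_smul])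
    have hYu := mulVec_eq_zero_of_tight (hu U) hxU (hX U) (hYs M) (hXY.2.2 U M hcc)
    exact (ker_eq_span_of_saturated (hu U) hYu (hsat U M hcc hXU hYM)).symm
  obtain ⟨i, -, hval⟩ := value_le_giant_class_add hr hne C w hBv hε hXY hXt κ lam hclosed hSNT hdens
  suffices hcl : ∑ U ∈ univ.filter (fun U => κ U = i), ∑ M, levelWeight n t C w U M * (X U * Y M).trace ≤ γ by linarith
  -- the giant class `{U : ℝ·u_U = i}` is a dictionary of size one
  set A : Finset (OddSet n) := univ.filter (fun U => κ U = i) with hA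
  rcases A.eq_empty_or_nonempty with hA0 | ⟨U₀, hU₀⟩
  · rw [hA0, sum_empty]
    have h := hγ (fun _ => 0) (fun _ => 0) ⟨fun _ => ⟨PosSemidef.zero, by rw [sub_zero]; exact PosSemidef.one⟩,
      fun _ => ⟨PosSemidef.zero, by rw [sub_zero]; exact PosSemidef.one⟩, fun _ _ _ => Matrix.zero_mul _⟩
    simpa using h
  set ustar := u U₀ with hustar
  -- on the class, `u_U u_Uᵀ = u* u*ᵀ`
  have hclass : ∀ U ∈ A, vecMulVec (u U) (u U) = vecMulVec ustar ustar := by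
    intro U hU
    have hi : κ U = κ U₀ := by rw [(mem_filter.1 hU).2, (mem_filter.1 hU₀).2]
    have hmem : u U ∈ ℝ ∙ u U₀ := by
      have : u U ∈ κ U := Submodule.mem_span_singleton_self _
      rw [hi] at this; exact this
    obtain ⟨a, ha⟩ := Submodule.mem_span_singleton.1 hmem
    have ha2 : a * a = 1 := by
      have h := hu U
      rw [← ha, smul_dotProduct, dotProduct_smul, hu U₀, smul_eq_mul, smul_eq_mul, mul_one] at h
      exact h
    rw [← ha, hustar]
    ext j k
    simp only [vecMulVec_apply, Pi.smul_apply, smul_eq_mul]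
    calc a * u U₀ j * (a * u U₀ k) = (a * a) * (u U₀ j * u U₀ k) := by ring
      _ = u U₀ j * u U₀ k := by rw [ha2, one_mul]
  -- the restricted cut side as a dictionary with one direction
  set X' : OddSet n → Matrix (Fin r) (Fin r) ℝ := fun U => if U ∈ A then X U else 0 with hX'
  have hX'dict : ∀ U, X' U = ∑ _d : Unit, (if U ∈ A then x U else 0) • vecMulVec ustar ustar := by
    intro U
    rw [Fintype.sum_unique]
    by_cases hU : U ∈ A
    · simp only [hX', hU, if_true]; rw [hX U, hclass U hU]
    · simp only [hX', hU, if_false, zero_smul]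
  have hval' : ∑ U ∈ A, ∑ M, levelWeight n t C w U M * (X U * Y M).trace =
      ∑ U, ∑ M, levelWeight n t C w U M * (X' U * Y M).trace := by
    rw [← sum_filter_add_sum_filter_not univ (fun U => U ∈ A) (fun U => ∑ M, levelWeight n t C w U M * (X' U * Y M).trace)]
    have h0 : ∑ U ∈ univ.filter (fun U => ¬U ∈ A), ∑ M, levelWeight n t C w U M * (X' U * Y M).trace = 0 :=
      sum_eq_zero fun U hU => sum_eq_zero fun M _ => by
        rw [hX']; dsimp only; rw [if_neg (mem_filter.1 hU).2, Matrix.zero_mul, trace_zero, mul_zero]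
    rw [h0, add_zero, filter_mem_eq_inter, univ_inter]
    exact sum_congr rfl fun U hU => sum_congr rfl fun M _ => by rw [hX']; dsimp only; rw [if_pos hU]
  rw [hval']
  have h := value_le_of_cutDictionary (levelWeight n t C w) γ hγ (fun _ : Unit => ustar) (fun _ => (hu U₀).le)
    (fun U _ => if U ∈ A then x U else 0)
    (fun U _ => by split_ifs <;> [exact hx U; exact ⟨le_rfl, zero_le_one⟩]) X' Y hX'dict hXY.2.1
    (fun U M hcc => by
      rw [hX']; dsimp only; split_ifs
      · rw [hXY.2.2 U M hcc, trace_zero]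
      · rw [Matrix.zero_mul, trace_zero])
  simpa using h

end Summit.PneNP.PneNP.Theorems.ChebyshevTracialDesignSaturatedSynchronisation
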